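import Mathlib
import HarnessLib
import Summits.Parity.Statement
import Summits.Parity.GeneralizedHardyLittlewood.Theses.LevelDescent

/-!
# Assembly of route-Parity-LevelDescent (item stmt-Parity-29038)

`Assembly : LevelJoint → LevelLift → FibrationLift → GeneralizedHardyLittlewood` is literally the route's certified deciding theorem `closes`
(node G2.2 «LevelDescent» (decomp-parity lens-3 g3; level coordinate of the parity-neutral-majorant family; rev 0)): the joint-GPY-majorant lower bound and the declared lift give DimOne, and the fibration lemma lifts to all d.  One line; no mathematics beyond the route file.
-/

namespace Summit.Parity.GeneralizedHardyLittlewood.Theses.LevelDescent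

/-- Assembly item stmt-Parity-29038 of route-Parity-LevelDescent:
`LevelJoint → LevelLift → FibrationLift → GeneralizedHardyLittlewood`,
by the route's deciding theorem `closes`. -/
theorem assembly_proof : Assembly :=
  fun h1 h2 h3 => closes h1 h2 h3

end Summit.Parity.GeneralizedHardyLittlewood.Theses.LevelDescent
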